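import Summits.Ventures.PercRepro.S1CoreCapSevenThin
import Summits.Ventures.PercRepro.S1CoreCapSevenPlane

/-!
# PercRepro — TOWARDS `Q*(7) = 19`: THREE BIG LINES IN A PLANE (p1, gen 26)

Three lines of `≥ 4` points whose list has `lineRank ≤ 3` (the TRIANGLE shape) at nullity `7`. The plane on them
(`exists_plane`) has `≤ 9` points (h5) and contains their union of `≥ 12 − 3 = 9` points, so it IS their union and
all three are 4-point lines (`plane_of_three_big`); by maximality every other line is a TRANSVERSAL inside the plane
(one point on each big line, off the vertices) or meets the plane in `≤ 1` point — no chord through a hub off the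
plane (two old points would enlarge the plane to `10` points). The transversals inject into the `2 × 2` private
points of two big lines (`card_transversals_le_four`); a fat point of the plane is on `≤ 3` of its lines
(`sum_fat_plane_le'`: `3 + 2 (d − 1) ≤ 8`), the cost clause allows at most one; the thin family outside has budget
`1 − f₀`. Cap `≤ 12 + 4 + 3 f₀ + (1 − f₀) ≤ 19`, attained at `f₀ = 1` (two simple 4-lines, a `(4,1)` line, four
transversals, two through the fat point): `sum_cap_le_nineteen_of_three_big_plane`. `proofs/P1-S4-CAPBRIDGE.md`
§18 (ii). Axioms: standard.
-/

namespace PercRepro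

namespace S1

namespace FourCap

namespace Seven

variable {β : Type} [DecidableEq β]

/-! ### Degrees in a plane whose points lie on big lines -/
/-- **A fat point on a big line of a plane lies on at most `(c − 2) / 2` of its lines**, summed: for a
duplicate-free list `l` of lines of `≥ 3` points pairwise sharing at most one point, every point of whose union
lies on a line of `l` with `≥ 4` points, `Σ_{L ∈ l} fat L ≤ fat (unionL l) · ((|unionL l| − 2) / 2)`. -/
theorem sum_fat_plane_le' (w : β → ℕ) (l : List (Finset β)) (h3 : ∀ L ∈ l, 3 ≤ L.card)
    (hpair : ∀ L ∈ l, ∀ L' ∈ l, L ≠ L' → (L ∩ L').card ≤ 1)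
    (hbig : ∀ p ∈ unionL l, ∃ B ∈ l, p ∈ B ∧ 4 ≤ B.card) :
    ∑ L ∈ l.toFinset, fat w L ≤ fat w (unionL l) * (((unionL l).card - 2) / 2) := by
  set P₀ := unionL l with hP₀
  have hsub : ∀ L ∈ l.toFinset, L ⊆ P₀ := fun L hL v hv => mem_unionL_iff.2 ⟨L, List.mem_toFinset.1 hL, hv⟩
  have hline : ∀ L ∈ l.toFinset, fat w L = ∑ p ∈ P₀.filter (fun u => w u = 2), if p ∈ L then 1 else 0 := by
    intro L hL
    unfold fat
    have e : L.filter (fun u => w u = 2) = (P₀.filter (fun u => w u = 2)).filter (fun p => p ∈ L) := by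
      ext u
      simp only [Finset.mem_filter]
      exact ⟨fun h => ⟨⟨hsub L hL h.1, h.2⟩, h.1⟩, fun h => ⟨h.2, h.1.2⟩⟩
    rw [e, Finset.card_filter]
  rw [Finset.sum_congr rfl hline, Finset.sum_comm]
  have hdeg : ∀ p ∈ P₀.filter (fun u => w u = 2),
      (∑ L ∈ l.toFinset, if p ∈ L then 1 else 0) ≤ (P₀.card - 2) / 2 := by
    intro p hp
    have hpP : p ∈ P₀ := (Finset.mem_filter.1 hp).1
    rw [← Finset.card_filter]
    set D := l.toFinset.filter (fun L => p ∈ L) with hD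
    have hDmem : ∀ L ∈ D, L ∈ l ∧ p ∈ L := fun L hL => by
      have h := Finset.mem_filter.1 hL
      exact ⟨List.mem_toFinset.1 h.1, h.2⟩
    have hdisj : ∀ L ∈ D, ∀ L' ∈ D, L ≠ L' → Disjoint (L.erase p) (L'.erase p) := by
      intro L hL L' hL' hne
      rw [Finset.disjoint_left]
      intro u hu hu'
      have h1 := Finset.mem_erase.1 hu
      have h2 := Finset.mem_erase.1 hu'
      have hint := hpair L (hDmem L hL).1 L' (hDmem L' hL').1 hne
      exact h1.1 (Finset.card_le_one.1 hint u (Finset.mem_inter.2 ⟨h1.2, h2.2⟩) p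
        (Finset.mem_inter.2 ⟨(hDmem L hL).2, (hDmem L' hL').2⟩))
    have hcard := Finset.card_biUnion hdisj
    -- the big line through `p`
    obtain ⟨B, hBl, hpB, hB4⟩ := hbig p hpP
    have hBD : B ∈ D := Finset.mem_filter.2 ⟨List.mem_toFinset.2 hBl, hpB⟩
    have hsum : 2 * D.card + 1 ≤ ∑ L ∈ D, (L.erase p).card := by
      rw [← Finset.add_sum_erase D _ hBD, Finset.card_erase_of_mem hpB]
      have h2 : ∀ L ∈ D.erase B, 2 ≤ (L.erase p).card := fun L hL => by
        have hL' := Finset.mem_of_mem_erase hL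
        rw [Finset.card_erase_of_mem (hDmem L hL').2]
        have := h3 L (hDmem L hL').1
        omega
      have := Finset.sum_le_sum h2
      rw [Finset.sum_const_nat (m := 2) (fun _ _ => rfl), Finset.card_erase_of_mem hBD] at this
      have hpos : 1 ≤ D.card := Finset.card_pos.2 ⟨B, hBD⟩
      omega
    have hsub' : D.biUnion (fun L => L.erase p) ⊆ P₀.erase p := by
      intro u hu
      obtain ⟨L, hL, hu⟩ := Finset.mem_biUnion.1 hu
      have h := Finset.mem_erase.1 hu
      exact Finset.mem_erase.2 ⟨h.1, hsub L (Finset.mem_filter.1 hL).1 h.2⟩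
    have hle := Finset.card_le_card hsub'
    rw [hcard, Finset.card_erase_of_mem hpP] at hle
    omega
  refine (Finset.sum_le_sum hdeg).trans ?_
  rw [Finset.sum_const_nat (m := (P₀.card - 2) / 2) (fun _ _ => rfl)]
  rfl

/-! ### The triangle -/
section ThreeBig

variable {w : β → ℕ} {ls : Finset (Finset β)}
  (h1 : ∀ L ∈ ls, ∀ v ∈ L, w v = 1 ∨ w v = 2)
  (h2 : ∀ L ∈ ls, 3 ≤ L.card ∧ wsum w L ≤ 5)
  (h3 : ∀ L ∈ ls, ∀ L' ∈ ls, L ≠ L' → (L ∩ L').card ≤ 1)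
  (h4 : ∀ l : List (Finset β), l.Nodup → (∀ L ∈ l, L ∈ ls) → wsum w (unionL l) ≤ 7 + lineRank l)
  (h5 : ∀ l : List (Finset β), l.Nodup → (∀ L ∈ l, L ∈ ls) → lineRank l ≤ 3 → (unionL l).card ≤ 9)
  {L₁ L₂ L₃ : Finset β} (hL₁ : L₁ ∈ ls) (hL₂ : L₂ ∈ ls) (hL₃ : L₃ ∈ ls)
  (h12 : L₂ ≠ L₁) (h13 : L₃ ≠ L₁) (h23 : L₃ ≠ L₂)
  (c1 : 4 ≤ L₁.card) (c2 : 4 ≤ L₂.card) (c3 : 4 ≤ L₃.card)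
  (hrest : ∀ L ∈ ls, L ≠ L₁ → L ≠ L₂ → L ≠ L₃ → L.card = 3)

include h3 hL₁ hL₂ hL₃ h12 h13 h23 c1 c2 c3 in
/-- **The plane of three big lines of rank `≤ 3` is their union**: a list `l` of lines of `ls` with `lineRank l ≤ 3`
containing `L₁, L₂, L₃` has `unionL l = L₃ ∪ (L₂ ∪ L₁)` of exactly `9` points, and the three are 4-point lines
meeting pairwise (`|L₂ ∩ L₁| = 1`, `|L₃ ∩ (L₂ ∪ L₁)| = 2`), given `|unionL l| ≤ 9`. -/
theorem plane_of_three_big {l : List (Finset β)} (hl₁ : L₁ ∈ l) (hl₂ : L₂ ∈ l) (hl₃ : L₃ ∈ l)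
    (hc9 : (unionL l).card ≤ 9) :
    unionL l = L₃ ∪ (L₂ ∪ L₁) ∧ (unionL l).card = 9 ∧ L₁.card = 4 ∧ L₂.card = 4 ∧ L₃.card = 4 ∧
      (L₂ ∩ L₁).card = 1 ∧ (L₃ ∩ (L₂ ∪ L₁)).card = 2 := by
  have hsub : L₃ ∪ (L₂ ∪ L₁) ⊆ unionL l := by
    intro v hv
    rcases Finset.mem_union.1 hv with h | h
    · exact mem_unionL_iff.2 ⟨L₃, hl₃, h⟩
    rcases Finset.mem_union.1 h with h | h
    · exact mem_unionL_iff.2 ⟨L₂, hl₂, h⟩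
    · exact mem_unionL_iff.2 ⟨L₁, hl₁, h⟩
  have hle := Finset.card_le_card hsub
  have u2 := Finset.card_union_add_card_inter L₂ L₁
  have u3 := Finset.card_union_add_card_inter L₃ (L₂ ∪ L₁)
  have p21 := h3 L₂ hL₂ L₁ hL₁ h12
  have i3 : (L₃ ∩ (L₂ ∪ L₁)).card ≤ 2 := le_trans (card_inter_union_le L₃ L₂ L₁)
    (by have := h3 L₃ hL₃ L₂ hL₂ h23; have := h3 L₃ hL₃ L₁ hL₁ h13; omega)
  have heq : L₃ ∪ (L₂ ∪ L₁) = unionL l := Finset.eq_of_subset_of_card_le hsub (by omega)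
  exact ⟨heq.symm, by omega, by omega, by omega, by omega, by omega, by omega⟩

omit [DecidableEq β] in
/-- The cap of a 4-point line with at most one fat point is `4 + fat`. -/
theorem capPaper_four_eq {f : ℕ} (hf : f ≤ 1) : capPaper 4 f = 4 + f := by
  rcases (by omega : f = 0 ∨ f = 1) with rfl | rfl <;> decide

/-- A 3-point set covered by three sets meeting it in at most one point each meets each in exactly one point. -/
theorem inter_eq_one_of_cover {X A B C : Finset β} (hX : X.card = 3) (hA : (X ∩ A).card ≤ 1)
    (hB : (X ∩ B).card ≤ 1) (hC : (X ∩ C).card ≤ 1) (hsub : X ⊆ A ∪ (B ∪ C)) :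
    (X ∩ A).card = 1 ∧ (X ∩ B).card = 1 ∧ (X ∩ C).card = 1 := by
  have hcover : X ⊆ (X ∩ A) ∪ ((X ∩ B) ∪ (X ∩ C)) := by
    intro v hv
    have h := hsub hv
    simp only [Finset.mem_union, Finset.mem_inter]
    rcases Finset.mem_union.1 h with h | h
    · exact Or.inl ⟨hv, h⟩
    rcases Finset.mem_union.1 h with h | h
    · exact Or.inr (Or.inl ⟨hv, h⟩)
    · exact Or.inr (Or.inr ⟨hv, h⟩)
  have hc := Finset.card_le_card hcover
  have hu1 := Finset.card_union_le (X ∩ A) ((X ∩ B) ∪ (X ∩ C))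
  have hu2 := Finset.card_union_le (X ∩ B) (X ∩ C)
  omega

/-- A point of a transversal on two of the three sets is impossible (the third point would be a second point
on one set). -/
theorem not_mem_two_of_cover {X A B C : Finset β} (hX : X.card = 3) (hA : (X ∩ A).card ≤ 1)
    (hB : (X ∩ B).card ≤ 1) (hC : (X ∩ C).card ≤ 1) (hsub : X ⊆ A ∪ (B ∪ C)) {a : β} (haX : a ∈ X)
    (haA : a ∈ A) (haB : a ∈ B) : False := by
  -- every point of `X` is `a` or lies in `C`: so `X ⊆ {a} ∪ (X ∩ C)`
  have hcover : X ⊆ {a} ∪ (X ∩ C) := by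
    intro v hv
    have h := hsub hv
    rcases Finset.mem_union.1 h with h | h
    · exact Finset.mem_union_left _ (Finset.mem_singleton.2
        (Finset.card_le_one.1 hA v (Finset.mem_inter.2 ⟨hv, h⟩) a (Finset.mem_inter.2 ⟨haX, haA⟩)))
    rcases Finset.mem_union.1 h with h | h
    · exact Finset.mem_union_left _ (Finset.mem_singleton.2
        (Finset.card_le_one.1 hB v (Finset.mem_inter.2 ⟨hv, h⟩) a (Finset.mem_inter.2 ⟨haX, haB⟩)))
    · exact Finset.mem_union_right _ (Finset.mem_inter.2 ⟨hv, h⟩)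
  have := Finset.card_le_card hcover
  have := Finset.card_union_le ({a} : Finset β) (X ∩ C)
  rw [Finset.card_singleton] at this
  omega

include h3 hL₁ hL₂ hL₃ h13 h23 in
/-- **At most four transversals**: the 3-point lines of `ls` inside the union of three 4-point lines meeting
pairwise (`|L₂ ∩ L₁| = 1`, `|L₃ ∩ (L₂ ∪ L₁)| = 2`) inject into `(L₁ ∖ (L₂ ∪ L₃)) × (L₂ ∖ (L₁ ∪ L₃))` by their
points on `L₁` and `L₂`, a `2 × 2` set. -/
theorem card_transversals_le_four (k1 : L₁.card = 4) (k2 : L₂.card = 4)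
    (e21 : (L₂ ∩ L₁).card = 1) (e3 : (L₃ ∩ (L₂ ∪ L₁)).card = 2) (S : Finset (Finset β))
    (hS : ∀ X ∈ S, X ∈ ls ∧ X ≠ L₁ ∧ X ≠ L₂ ∧ X ≠ L₃ ∧ X.card = 3 ∧ X ⊆ L₃ ∪ (L₂ ∪ L₁)) : S.card ≤ 4 := by
  have hi3 := card_inter_union_le L₃ L₂ L₁
  have p32 := h3 L₃ hL₃ L₂ hL₂ h23
  have p31 := h3 L₃ hL₃ L₁ hL₁ h13
  have e31 : (L₃ ∩ L₁).card = 1 := by omega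
  have e32 : (L₃ ∩ L₂).card = 1 := by omega
  -- the two vertices on `L₁` (resp. `L₂`) are distinct: a common point of all three lines would leave
  -- `|L₃ ∩ (L₂ ∪ L₁)| = 1`
  have hno3 : ∀ v, v ∈ L₁ → v ∈ L₂ → v ∈ L₃ → False := by
    intro v hv1 hv2 hv3
    have : L₃ ∩ (L₂ ∪ L₁) ⊆ {v} := by
      intro u hu
      have hu3 := (Finset.mem_inter.1 hu).1
      rcases Finset.mem_union.1 (Finset.mem_inter.1 hu).2 with hu2 | hu1
      · exact Finset.mem_singleton.2 (Finset.card_le_one.1 p32 u (Finset.mem_inter.2 ⟨hu3, hu2⟩) v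
          (Finset.mem_inter.2 ⟨hv3, hv2⟩))
      · exact Finset.mem_singleton.2 (Finset.card_le_one.1 p31 u (Finset.mem_inter.2 ⟨hu3, hu1⟩) v
          (Finset.mem_inter.2 ⟨hv3, hv1⟩))
    have := Finset.card_le_card this
    rw [Finset.card_singleton] at this
    omega
  have hA2 : (L₁ \ (L₂ ∪ L₃)).card ≤ 2 := by
    have h := Finset.card_sdiff_add_card_inter L₁ (L₂ ∪ L₃)
    have hdisj : Disjoint (L₁ ∩ L₂) (L₁ ∩ L₃) := by
      rw [Finset.disjoint_left]
      intro v hv hv'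
      exact hno3 v (Finset.mem_inter.1 hv).1 (Finset.mem_inter.1 hv).2 (Finset.mem_inter.1 hv').2
    have hsub : (L₁ ∩ L₂) ∪ (L₁ ∩ L₃) ⊆ L₁ ∩ (L₂ ∪ L₃) := by
      rw [Finset.inter_union_distrib_left]
    have := Finset.card_le_card hsub
    rw [Finset.card_union_of_disjoint hdisj, Finset.inter_comm L₁ L₂, Finset.inter_comm L₁ L₃] at this
    omega
  have hB2 : (L₂ \ (L₁ ∪ L₃)).card ≤ 2 := by
    have h := Finset.card_sdiff_add_card_inter L₂ (L₁ ∪ L₃)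
    have hdisj : Disjoint (L₂ ∩ L₁) (L₂ ∩ L₃) := by
      rw [Finset.disjoint_left]
      intro v hv hv'
      exact hno3 v (Finset.mem_inter.1 hv).2 (Finset.mem_inter.1 hv).1 (Finset.mem_inter.1 hv').2
    have hsub : (L₂ ∩ L₁) ∪ (L₂ ∩ L₃) ⊆ L₂ ∩ (L₁ ∪ L₃) := by
      rw [Finset.inter_union_distrib_left]
    have := Finset.card_le_card hsub
    rw [Finset.card_union_of_disjoint hdisj, Finset.inter_comm L₂ L₃] at this
    omega
  -- the transversals' points
  have hpts : ∀ X ∈ S, (X ∩ L₁).card = 1 ∧ (X ∩ L₂).card = 1 ∧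
      (∀ a ∈ X ∩ L₁, a ∉ L₂ ∧ a ∉ L₃) ∧ (∀ b ∈ X ∩ L₂, b ∉ L₁ ∧ b ∉ L₃) := by
    intro X hX
    obtain ⟨hXls, hX1, hX2, hX3, hXc, hXsub⟩ := hS X hX
    have i1 := h3 X hXls L₁ hL₁ hX1
    have i2 := h3 X hXls L₂ hL₂ hX2
    have i3 := h3 X hXls L₃ hL₃ hX3
    obtain ⟨f3, f2, f1⟩ := inter_eq_one_of_cover hXc i3 i2 i1 hXsub
    refine ⟨f1, f2, fun a ha => ⟨fun h => ?_, fun h => ?_⟩, fun b hb => ⟨fun h => ?_, fun h => ?_⟩⟩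
    · exact not_mem_two_of_cover hXc i1 i2 i3 (by
        intro v hv; have := hXsub hv; simp only [Finset.mem_union] at this ⊢; tauto)
        (Finset.mem_inter.1 ha).1 (Finset.mem_inter.1 ha).2 h
    · exact not_mem_two_of_cover hXc i1 i3 i2 (by
        intro v hv; have := hXsub hv; simp only [Finset.mem_union] at this ⊢; tauto)
        (Finset.mem_inter.1 ha).1 (Finset.mem_inter.1 ha).2 h
    · exact not_mem_two_of_cover hXc i2 i1 i3 (by
        intro v hv; have := hXsub hv; simp only [Finset.mem_union] at this ⊢; tauto)
        (Finset.mem_inter.1 hb).1 (Finset.mem_inter.1 hb).2 h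
    · exact not_mem_two_of_cover hXc i2 i3 i1 (by
        intro v hv; have := hXsub hv; simp only [Finset.mem_union] at this ⊢; tauto)
        (Finset.mem_inter.1 hb).1 (Finset.mem_inter.1 hb).2 h
  -- the injection `X ↦ (X ∩ L₁, X ∩ L₂)` into `A.powersetCard 1 ×ˢ B.powersetCard 1`
  have hmaps : ∀ X ∈ S, (X ∩ L₁, X ∩ L₂) ∈
      (L₁ \ (L₂ ∪ L₃)).powersetCard 1 ×ˢ (L₂ \ (L₁ ∪ L₃)).powersetCard 1 := by
    intro X hX
    obtain ⟨i1, i2, ha, hb⟩ := hpts X hX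
    refine Finset.mem_product.2 ⟨Finset.mem_powersetCard.2 ⟨fun a ha' => ?_, i1⟩,
      Finset.mem_powersetCard.2 ⟨fun b hb' => ?_, i2⟩⟩
    · exact Finset.mem_sdiff.2 ⟨(Finset.mem_inter.1 ha').2, fun h => by
        rcases Finset.mem_union.1 h with h | h
        · exact (ha a ha').1 h
        · exact (ha a ha').2 h⟩
    · exact Finset.mem_sdiff.2 ⟨(Finset.mem_inter.1 hb').2, fun h => by
        rcases Finset.mem_union.1 h with h | h
        · exact (hb b hb').1 h
        · exact (hb b hb').2 h⟩
  have hinj : Set.InjOn (fun X : Finset β => (X ∩ L₁, X ∩ L₂)) S := by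
    intro X hX Y hY hXY
    simp only [Prod.mk.injEq] at hXY
    obtain ⟨hXls, -, -, -, -, -⟩ := hS X hX
    obtain ⟨hYls, -, -, -, -, -⟩ := hS Y hY
    by_contra hne
    have hint := h3 X hXls Y hYls hne
    obtain ⟨i1, i2, ha, -⟩ := hpts X hX
    have hsub : (X ∩ L₁) ∪ (X ∩ L₂) ⊆ X ∩ Y := by
      intro v hv
      rcases Finset.mem_union.1 hv with h | h
      · have h' : v ∈ Y ∩ L₁ := hXY.1 ▸ h
        exact Finset.mem_inter.2 ⟨(Finset.mem_inter.1 h).1, (Finset.mem_inter.1 h').1⟩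
      · have h' : v ∈ Y ∩ L₂ := hXY.2 ▸ h
        exact Finset.mem_inter.2 ⟨(Finset.mem_inter.1 h).1, (Finset.mem_inter.1 h').1⟩
    have hdisj : Disjoint (X ∩ L₁) (X ∩ L₂) := by
      rw [Finset.disjoint_left]
      intro v hv hv'
      exact (ha v hv).1 (Finset.mem_inter.1 hv').2
    have := Finset.card_le_card hsub
    rw [Finset.card_union_of_disjoint hdisj] at this
    omega
  have := Finset.card_le_card_of_injOn _ hmaps hinj
  rw [Finset.card_product, Finset.card_powersetCard, Finset.card_powersetCard, Nat.choose_one_right,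
    Nat.choose_one_right] at this
  calc S.card ≤ (L₁ \ (L₂ ∪ L₃)).card * (L₂ \ (L₁ ∪ L₃)).card := this
    _ ≤ 2 * 2 := Nat.mul_le_mul hA2 hB2

include h1 h2 h3 h4 h5 hL₁ hL₂ hL₃ h12 h13 h23 c1 c2 c3 hrest in
/-- **Three big lines in a plane: cap sum `≤ 19`** — given `lineRank [L₃, L₂, L₁] ≤ 3`, the plane on them is their
union of nine points (three 4-point lines meeting pairwise), its other lines are at most four transversals, a fat
point of it lies on at most three of its lines and there is at most one, and the thin family outside has budget
`1 − f₀`: cap `≤ 12 + 4 + 3 f₀ + (1 − f₀)`. -/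
theorem sum_cap_le_nineteen_of_three_big_plane (hr : lineRank [L₃, L₂, L₁] ≤ 3) :
    ∑ L ∈ ls, capPaper L.card (fat w L) ≤ 19 := by
  have h2' := two_le_card_of_spec₇ h2
  obtain ⟨l, hnd, hls, hr', hsub, hmax⟩ := exists_plane ls _ [L₃, L₂, L₁] le_rfl (by simp [h12, h13, h23])
    (by simp [hL₁, hL₂, hL₃]) hr
  have hc9 : (unionL l).card ≤ 9 := card_plane_le_nine h5 hnd hls hr'
  obtain ⟨hU, hc, k1, k2, k3, e21, e3⟩ := plane_of_three_big h3 hL₁ hL₂ hL₃ h12 h13 h23 c1 c2 c3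
    (hsub L₁ (by simp)) (hsub L₂ (by simp)) (hsub L₃ (by simp)) hc9
  -- the fat points of the plane: at most one, each on at most three of its lines
  have hfatin := sum_fat_plane_le' w l (fun L hL => (h2 L (hls L hL)).1)
    (fun L hL L' hL' hne => h3 L (hls L hL) L' (hls L' hL') hne) (fun p hp => by
      rw [hU] at hp
      rcases Finset.mem_union.1 hp with h | h
      · exact ⟨L₃, hsub L₃ (by simp), h, c3⟩
      rcases Finset.mem_union.1 h with h | h
      · exact ⟨L₂, hsub L₂ (by simp), h, c2⟩
      · exact ⟨L₁, hsub L₁ (by simp), h, c1⟩)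
  rw [hc] at hfatin
  have hcs := wsum_unionL_eq w l (fun L hL => h1 L (hls L hL)) (fun L hL => h2' L (hls L hL))
  rw [wsum_eq_card_add_fat w (unionL l) (fun v hv => by
    obtain ⟨L, hL, hvL⟩ := mem_unionL_iff.1 hv
    exact h1 L (hls L hL) v hvL)] at hcs
  have hcost : (unionL l).card + fat w (unionL l) ≤ 10 := by
    have hb := costSum_le h1 h2' h4 l hnd hls
    omega
  -- the thin family outside
  set T := ls.filter (fun L => L ∉ l) with hT
  have hTmem : ∀ L ∈ T, L ∈ ls ∧ L ∉ l := fun L hL => Finset.mem_filter.1 hL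
  have hT3 : ∀ L ∈ T, L.card = 3 := fun L hL => hrest L (hTmem L hL).1
    (fun h => (hTmem L hL).2 (h ▸ hsub L₁ (by simp))) (fun h => (hTmem L hL).2 (h ▸ hsub L₂ (by simp)))
    (fun h => (hTmem L hL).2 (h ▸ hsub L₃ (by simp)))
  have hk : ∀ t : List (Finset β), t.Nodup → (∀ L ∈ t, L ∈ T) →
      freeCountR (unionL l) t + fat w (unionLR (unionL l) t \ unionL l) ≤
        10 - (unionL l).card - fat w (unionL l) := by
    intro t hndt hlt
    have hb := budget_of_prefix h1 h2' h4 l t (by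
      rw [List.nodup_append']
      exact ⟨hndt, hnd, fun L hLt hLl => (hTmem L (hlt L hLt)).2 hLl⟩)
      (fun L hL => by
        rcases List.mem_append.1 hL with hL | hL
        · exact (hTmem L (hlt L hL)).1
        · exact hls L hL)
      (fun L hL => hT3 L (hlt L hL))
    have hsplit := fat_sdiff_add_fat_of_subset w (subset_unionLR (unionL l) t)
    omega
  have hthin := two_mul_sum_cap_thin_le w (unionL l) T
    (fun L hL => ⟨hT3 L hL, hmax L (hTmem L hL).1 (hTmem L hL).2⟩)
    (fun L hL L' hL' hne => h3 L (hTmem L hL).1 L' (hTmem L' hL').1 hne)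
    (fun L hL => h1 L (hTmem L hL).1) (fun L hL => (h2 L (hTmem L hL).1).2) hk
  rw [hc] at hthin hcost
  -- the plane: the three big lines and the transversals
  set S := ((l.toFinset.erase L₁).erase L₂).erase L₃ with hS
  have hSmem : ∀ X ∈ S, X ∈ l ∧ X ≠ L₁ ∧ X ≠ L₂ ∧ X ≠ L₃ := fun X hX => by
    have h3' := Finset.mem_erase.1 hX
    have h2'' := Finset.mem_erase.1 h3'.2
    have h1' := Finset.mem_erase.1 h2''.2
    exact ⟨List.mem_toFinset.1 h1'.2, h1'.1, h2''.1, h3'.1⟩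
  have hS4 : S.card ≤ 4 := card_transversals_le_four h3 hL₁ hL₂ hL₃ h13 h23 k1 k2 e21 e3 S
    (fun X hX => by
      obtain ⟨hXl, hX1, hX2, hX3⟩ := hSmem X hX
      refine ⟨hls X hXl, hX1, hX2, hX3, hrest X (hls X hXl) hX1 hX2 hX3, ?_⟩
      rw [← hU]
      exact fun v hv => mem_unionL_iff.2 ⟨X, hXl, hv⟩)
  -- the sum over the plane
  have hsplit := Finset.sum_filter_add_sum_filter_not ls (fun L => L ∈ l) (fun L => capPaper L.card (fat w L))
  have hfil : ls.filter (fun L => L ∈ l) = l.toFinset := by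
    ext L
    simp only [Finset.mem_filter, List.mem_toFinset]
    exact ⟨fun h => h.2, fun h => ⟨hls L h, h⟩⟩
  rw [hfil, ← hT] at hsplit
  rw [← hsplit]
  have hL₁l : L₁ ∈ l.toFinset := List.mem_toFinset.2 (hsub L₁ (by simp))
  have hL₂l : L₂ ∈ (l.toFinset.erase L₁) := Finset.mem_erase.2 ⟨h12, List.mem_toFinset.2 (hsub L₂ (by simp))⟩
  have hL₃l : L₃ ∈ ((l.toFinset.erase L₁).erase L₂) :=
    Finset.mem_erase.2 ⟨h23, Finset.mem_erase.2 ⟨h13, List.mem_toFinset.2 (hsub L₃ (by simp))⟩⟩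
  have hcap4 : ∀ L ∈ ls, L.card = 4 → capPaper L.card (fat w L) = 4 + fat w L := by
    intro L hL hc4
    have := wsum_eq_card_add_fat w L (h1 L hL)
    have := (h2 L hL).2
    rw [hc4, capPaper_four_eq (by omega)]
  have hcap3 : ∀ X ∈ S, capPaper X.card (fat w X) = 1 + fat w X := by
    intro X hX
    obtain ⟨hXl, hX1, hX2, hX3⟩ := hSmem X hX
    have hXls := hls X hXl
    have := wsum_eq_card_add_fat w X (h1 X hXls)
    have := (h2 X hXls).2
    have hXc := hrest X hXls hX1 hX2 hX3
    rw [hXc, capPaper_three_eq' (by omega)]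
  have esum : ∀ f : Finset β → ℕ, ∑ L ∈ l.toFinset, f L = f L₁ + (f L₂ + (f L₃ + ∑ X ∈ S, f X)) := by
    intro f
    rw [← Finset.add_sum_erase _ f hL₁l, ← Finset.add_sum_erase _ f hL₂l, ← Finset.add_sum_erase _ f hL₃l]
  rw [esum, hcap4 L₁ hL₁ k1, hcap4 L₂ hL₂ k2, hcap4 L₃ hL₃ k3, Finset.sum_congr rfl hcap3,
    Finset.sum_add_distrib, Finset.sum_const_nat (m := 1) (fun _ _ => rfl), Nat.mul_one]
  rw [esum] at hfatin
  have hf1 : fat w (unionL l) ≤ 1 := by omega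
  rcases (by omega : fat w (unionL l) = 0 ∨ fat w (unionL l) = 1) with hf | hf <;> rw [hf] at hthin hfatin <;> omega

end ThreeBig

end Seven

end FourCap

end S1

end PercRepro
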